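import Mathlib
import HarnessLib
import Summits.ResolutionOfSingularities.ResolutionOfSingularities.Theorems.WildQuotientsWildQuotientResolutionS1aBlowupNodeAtlas

/-!
# S1a — stub `stub_blowupNodeAtlas` of line `s1a-logminvertex` v4 CLOSED (by name)

[OURS · L1 W4.5c · lead-1 g6] — NOT a statement of the manuscript; counted 0; AI-level work, weaker than expert
review. Crux stmt-ResolutionOfSingularities-17941 (`WildQuotients.CyclicQuotientFourfolds`), skeleton
`Cruxes/CyclicQuotientFourfolds/Lines/s1a_logminvertex.lean` v4 «GLOBAL FRAME» (plan-1 g11, registered 23:05:43Z):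
the registered stub `stub_blowupNodeAtlas : ∀ p : ℕ, 0 < p → BlowupNodeAtlas.{0} p` (A5b = residues (G1a)(G1b)(G1c)
of the frame) is the landed `BlowupCharts.blowupNodeAtlas_of_pos` (`…S1aBlowupNodeAtlas`, p585578) at universe `0`.
-/

set_option linter.dupNamespace false

noncomputable section

open Summit.ResolutionOfSingularities.ResolutionOfSingularities.Theorems.WildQuotientResolution.S1.MoveStep

namespace Summit.ResolutionOfSingularities.ResolutionOfSingularities.Theorems.WildQuotientResolution.S1

/-- **`stub_blowupNodeAtlas` (line `s1a-logminvertex` v4)**: for `0 < p` the blow-up of an admissible centre, with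
the lifted cyclic action, carries a node atlas. [OURS · L1 W4.5c] -/
theorem stub_blowupNodeAtlas : ∀ p : ℕ, 0 < p → BlowupNodeAtlas.{0} p :=
  fun _ hp => BlowupCharts.blowupNodeAtlas_of_pos hp

end Summit.ResolutionOfSingularities.ResolutionOfSingularities.Theorems.WildQuotientResolution.S1

end
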